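import Mathlib
import Literature.AlgebraicGeometry.Resolution.CobordantGame
import Literature.AlgebraicGeometry.Resolution.CobordantChartOneMove
import Summits.ResolutionOfSingularities.ResolutionOfSingularities.Theorems.WeightedInvariantLocalWeightedDropOffVertexConeWin

/-!
# `WeightedInvariant.LocalWeightedDrop`: S1's WILD POINT `X² + uZ⁴ + u³S⁴` — card A's HANDLE move, part one

Route `ResolutionOfSingularities/WeightedInvariant`, crux `LocalWeightedDrop`
(stmt-ResolutionOfSingularities-8899).  [OURS · L1 W4.3] — the first move of card A's play at S1's WILD
POINT `h = X² + uZ⁴ + u³S⁴` (`0 = X, 1 = Z, 2 = S, 3 = u`; ideator res-L1-w43-idea-1's Sketch v4 §9 R4-3 and RESULTS-r4 «S1W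
satP = {u}, (2;3;4,4) → one tame cusp-cylinder node»; res-L1-w43-tri-1 TRIAGE v7 (K1) «the HANDLE V(x,s,z)(2,1,1);4»): the
SATURATED move with centre `V(X, Z, S) ⊇ u`-axis and weights `w₁ = (2, 1, 1, 0)`, in the literal chart language of the crux.
Nothing here is a statement of the manuscript under review on ladder RESOLUTION; AI-produced, weaker than expert review.

`h` is `w₁`-WEIGHTED-HOMOGENEOUS of degree `4`, so the tree's singular-successor criterion reduces to the affine cone over the
points supported on `{X, Z, S}`: `∂_u h = Z⁴ (+ 3u²S⁴)` and `h = X² (+ …)` force `c = (0, 0, γ, –)`; every field.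

* `s1w_chart_axisS` — at `c = (0, 0, γ, –)` the chart transform is `s⁴ · H_γ`, `H_γ = X² + uZ⁴ + u³(γ + S)⁴ ∈ k⟦s, X, Z, S, u⟧`.
* `s1w_isSuccessor_classification` — EVERY singular `s`-saturated successor of `(X, w₁)` is `H_γ` for some `γ ≠ 0` (the ONE
  tame node of the sketch, up to the torus).
The second move (the characteristic-2 coordinate change to the cusp cylinder `X² + γ⁻²V³`) is the companion module `…S1WWon`.
-/

set_option linter.dupNamespace false -- mandated namespace of this single-conjunct summit
set_option autoImplicit false

namespace Summit.ResolutionOfSingularities.ResolutionOfSingularities.Theorems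

namespace GradedGame

open MvPowerSeries
open Literature.AlgebraicGeometry.Resolution
open Literature.AlgebraicGeometry.Resolution.CobordantChart

variable {k : Type} [Field k]

/-- The chart transform of S1W at an `S`-axis point `c = (0, 0, γ, –)` of the move `(X, (2,1,1,0))`:
`h(s²X, sZ, s(γ+S), u) = s⁴ · H_γ`. [OURS · L1 W4.3] -/
theorem s1w_chart_axisS (γ : k) :
    subst (chart ![2, 1, 1, 0] ![(0 : k), 0, γ, 0])
        (X 0 ^ 2 + X 3 * X 1 ^ 4 + X 3 ^ 3 * X 2 ^ 4 : MvPowerSeries (Fin 4) k)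
      = X (0 : Fin (4 + 1)) ^ 4 * (X 1 ^ 2 + X 4 * X 2 ^ 4 + X 4 ^ 3 * (C γ + X 3) ^ 4) := by
  have hc : ∀ i, (![2, 1, 1, 0] : Fin 4 → ℕ) i = 0 → (![(0 : k), 0, γ, 0] : Fin 4 → k) i = 0 := by
    intro i hi; fin_cases i <;> simp_all
  have hch := hasSubst_chart (![2, 1, 1, 0]) (![(0 : k), 0, γ, 0]) hc
  have h0 : chart ![2, 1, 1, 0] ![(0 : k), 0, γ, 0] 0 = X 0 ^ 2 * X 1 := by rw [chart_apply]; simp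
  have h1 : chart ![2, 1, 1, 0] ![(0 : k), 0, γ, 0] 1 = X 0 * X 2 := by rw [chart_apply]; simp
  have h2 : chart ![2, 1, 1, 0] ![(0 : k), 0, γ, 0] 2 = X 0 * (C γ + X 3) := by rw [chart_apply]; simp
  have h3 : chart ![2, 1, 1, 0] ![(0 : k), 0, γ, 0] 3 = X 4 := by rw [chart_apply]; simp
  simp only [← coe_substAlgHom hch, map_add, map_mul, map_pow, substAlgHom_X]
  rw [h0, h1, h2, h3]
  ring


/-- MOVE ONE of the HANDLE at S1's wild point: every singular `s`-saturated successor of the move `(X, (2,1,1,0))` (centre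
`V(X,Z,S) ⊇ u`-axis) is `H_γ = X² + uZ⁴ + u³(γ+S)⁴` for some `γ ≠ 0` — the exceptional points with a singular successor are
exactly the `S`-axis points `(0:0:γ:–)`.  Every field. [OURS · L1 W4.3] -/
theorem s1w_isSuccessor_classification (g : MvPowerSeries (Fin 5) k)
    (hg : CobordantGame.IsSuccessor k (X 0 ^ 2 + X 3 * X 1 ^ 4 + X 3 ^ 3 * X 2 ^ 4 : MvPowerSeries (Fin 4) k)
      MvPowerSeries.X ![2, 1, 1, 0] g) :
    ∃ γ : k, γ ≠ 0 ∧ g = X 1 ^ 2 + X 4 * X 2 ^ 4 + X 4 ^ 3 * (C γ + X 3) ^ 4 := by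
  classical
  obtain ⟨c, a, hoff, hfac, hndvd, hsing⟩ := hg
  set w : Fin 4 → ℕ := ![2, 1, 1, 0] with hw
  set P : MvPolynomial (Fin 4) k :=
    MvPolynomial.X 0 ^ 2 + MvPolynomial.X 3 * MvPolynomial.X 1 ^ 4 + MvPolynomial.X 3 ^ 3 * MvPolynomial.X 2 ^ 4 with hPdef
  have hcoe : (P : MvPowerSeries (Fin 4) k) = X 0 ^ 2 + X 3 * X 1 ^ 4 + X 3 ^ 3 * X 2 ^ 4 := by
    simp [hPdef, MvPolynomial.coe_add, MvPolynomial.coe_mul, MvPolynomial.coe_pow, MvPolynomial.coe_X]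
  -- the truncated point `c'` (the crux ignores `c_u` since `w_u = 0`)
  set c' : Fin 4 → k := fun i => if 0 < w i then c i else 0 with hc'
  have hc'0 : ∀ i, w i = 0 → c' i = 0 := fun i hi => by simp [hc', hi]
  have hfac' : subst (chart w c') (P : MvPowerSeries (Fin 4) k) = X 0 ^ a * g := by
    rw [hcoe, ← cruxChart_eq_chart]
    have : subst (MvPowerSeries.X : Fin 4 → MvPowerSeries (Fin 4) k)
        (X 0 ^ 2 + X 3 * X 1 ^ 4 + X 3 ^ 3 * X 2 ^ 4 : MvPowerSeries (Fin 4) k) =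
        X 0 ^ 2 + X 3 * X 1 ^ 4 + X 3 ^ 3 * X 2 ^ 4 := by rw [MvPowerSeries.subst_self]; rfl
    rw [← this]
    exact hfac
  -- `P` is `w`-homogeneous of degree `4`, non-zero
  have hw0 : w 0 = 2 := rfl
  have hw1 : w 1 = 1 := rfl
  have hw2 : w 2 = 1 := rfl
  have hw3 : w 3 = 0 := rfl
  have hP : P.IsWeightedHomogeneous w 4 := by
    have h0 := MvPolynomial.isWeightedHomogeneous_X (R := k) w 0
    have h1 := MvPolynomial.isWeightedHomogeneous_X (R := k) w 1
    have h2 := MvPolynomial.isWeightedHomogeneous_X (R := k) w 2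
    have h3 := MvPolynomial.isWeightedHomogeneous_X (R := k) w 3
    rw [hw0] at h0; rw [hw1] at h1; rw [hw2] at h2; rw [hw3] at h3
    have hA : (MvPolynomial.X 0 ^ 2 : MvPolynomial (Fin 4) k).IsWeightedHomogeneous w (2 • 2) := h0.pow 2
    have hB : (MvPolynomial.X 3 * MvPolynomial.X 1 ^ 4 : MvPolynomial (Fin 4) k).IsWeightedHomogeneous w (0 + 4 • 1) :=
      h3.mul (h1.pow 4)
    have hC : (MvPolynomial.X 3 ^ 3 * MvPolynomial.X 2 ^ 4 : MvPolynomial (Fin 4) k).IsWeightedHomogeneous w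
        (3 • 0 + 4 • 1) := (h3.pow 3).mul (h2.pow 4)
    have e1 : (2 • 2 : ℕ) = 4 := rfl
    have e2 : (0 + 4 • 1 : ℕ) = 4 := rfl
    have e3 : (3 • 0 + 4 • 1 : ℕ) = 4 := rfl
    rw [e1] at hA; rw [e2] at hB; rw [e3] at hC
    rw [hPdef]
    exact (hA.add hB).add hC
  have hP0 : P ≠ 0 := by
    intro h0
    have := congrArg (fun Q : MvPolynomial (Fin 4) k => (Q : MvPowerSeries (Fin 4) k)) h0
    simp only [hcoe, MvPolynomial.coe_zero] at this
    have h2 := congrArg (coeff (Finsupp.single (0 : Fin 4) 2)) this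
    rw [map_add, map_add, coeff_X_pow, if_pos rfl,
      X_dvd_iff.mp ((dvd_pow_self (X 1 : MvPowerSeries (Fin 4) k) (by norm_num)).mul_left _) _ (by simp),
      X_dvd_iff.mp ((dvd_pow_self (X 2 : MvPowerSeries (Fin 4) k) (by norm_num)).mul_left _) _ (by simp),
      map_zero] at h2
    simp at h2
  have hP0' : (P : MvPowerSeries (Fin 4) k) ≠ 0 := fun h => hP0 (MvPolynomial.coe_eq_zero_iff.mp h)
  -- the exponent is the weighted order `4`
  have ha : a = 4 := by
    have h1 := eq_weightedOrder_of_factor w c' hc'0 hP0' hfac' hndvd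
    rw [weightedOrder_coe_of_isWeightedHomogeneous w hP hP0] at h1
    exact_mod_cast h1
  subst ha
  -- the cone equations at `c'`
  obtain ⟨hPa, hD, -⟩ := (successor_singular_iff w c' hc'0 _ hfac').mp hsing
  rw [initEval_coe, hP.weightedHomogeneousComponent_same] at hPa
  have hD' : ∀ i, MvPolynomial.eval c' (MvPolynomial.pderiv i P) = 0 := by
    intro i
    have := hD i
    rwa [initEvalD_coe, hP.weightedHomogeneousComponent_same] at this
  have hc3 : c' 3 = 0 := hc'0 3 hw3
  have hc1 : c' 1 = 0 := by
    have := hD' 3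
    rw [hPdef] at this
    simp only [map_add, map_mul, map_pow, Derivation.leibniz, Derivation.leibniz_pow, MvPolynomial.pderiv_X,
      MvPolynomial.eval_X, smul_eq_mul] at this
    simpa [hc3] using this
  have hc0 : c' 0 = 0 := by
    rw [hPdef] at hPa
    simp only [map_add, map_mul, map_pow, MvPolynomial.eval_X] at hPa
    simpa [hc1, hc3] using hPa
  -- so `c'` is the `S`-axis point `(0, 0, γ, 0)`, `γ = c 2 ≠ 0`
  set γ : k := c 2 with hγ
  have hc2 : c' 2 = γ := by
    simp only [hc', hγ]
    rw [if_pos (by rw [hw2]; exact Nat.one_pos)]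
  have hcvec : c' = ![(0 : k), 0, γ, 0] := by
    funext i
    fin_cases i
    · simpa using hc0
    · simpa using hc1
    · simpa using hc2
    · simpa using hc3
  have hγ0 : γ ≠ 0 := by
    obtain ⟨i, hi, hci⟩ := hoff
    have hci' : c' i ≠ 0 := by simp only [hc']; rw [if_pos hi]; exact hci
    fin_cases i
    · exact absurd hc0 hci'
    · exact absurd hc1 hci'
    · rw [← hc2]; exact hci'
    · simp [hw] at hi
  refine ⟨γ, hγ0, ?_⟩
  -- cancel `s⁴`
  rw [hcvec, hcoe, s1w_chart_axisS] at hfac'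
  exact (mul_left_cancel₀ (pow_ne_zero 4 (nonZeroDivisors.ne_zero
    (X_mem_nonzeroDivisors (i := (0 : Fin (4 + 1))) (R := k)))) hfac').symm

end GradedGame

end Summit.ResolutionOfSingularities.ResolutionOfSingularities.Theorems
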